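import Summits.BirchSwinnertonDyer.BirchSwinnertonDyer.Theorems.Rank2ObservatoryTamagawaCert
import Summits.BirchSwinnertonDyer.BirchSwinnertonDyer.Theorems.Rank2ObservatoryTamagawaExactLocal
import Literature.NumberTheory.EllipticCurves.MatsunoCurvesRankProofs
import Literature.NumberTheory.EllipticCurves.TamagawaVariableChangeProofs
import HarnessLib

/-!
# BSD rank ≥ 2 observatory (`b2b-bsdr2`, cert-2 gen 10): EXACT local Tamagawa numbers for the
# Kodaira types `IV` and `IV*` — part 2/2: kernel certificates at the places of `ℚ` and exact rows

HONEST FRAMING: per-curve certified theorems and census instruments; no claim on BSD in rank ≥ 2.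

Theorems only (no named fact, no axiom).  Part 1 (`Rank2ObservatoryTamagawaExactLocal`) decides
`[E(K_v) : E₀(K_v)] ∈ {1, 3}` for an integer equation in the `IV` / `IV*` normal form cast into a
Henselian discrete valuation ring.  Here:
* `tam_eq_index_intModel` — the PLUMBING from the tree's local Tamagawa number
  `c_v = ((W₀ ⊗ ℚ) ⊗ ℚ_v).localTamagawaNumber O_v` (`tam W₀ v`, part 1/3 of the census files) to the index
  of the nonsingular-reduction subgroup of the CAST of a translated integer equation `M = (1,r,s,t) • W₀`
  minimal at `v`: model independence (`localTamagawaNumber_variableChange_holds`), "for a minimal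
  equation `c` is the index of the equation's own `E₀`" (`localTamagawaNumber_eq_index_goodReductionSubgroup`,
  Silverman *AEC* VII.1.3(b), VII.6 Ex. 7.6) and the bridge `goodReductionSubgroup_baseChange_eq`, in a
  presentation `p = ϖ ε` of `O_v` (`ℤ_p` is Henselian: tree, `AdicCompletionHensel`; its residue field is
  `ℤ/p`: `exists_nat_residue_eq`);
* `TamX` — a kernel-decidable EXACT certificate for `c_p` at a prime of type `IV` (`kind 1`: a root
  `m` of `m² + (a₃/p) m − a₆/p² ≡ 0`, `p ∤ (a₃/p)² + 4 a₆/p²` ⟹ `c_p = 3`; `kind 2`: no root among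
  `m < p` ⟹ `c_p = 1`) or `IV*` (`kinds 3, 4`, with `a₃/p²`, `a₆/p⁴`), on the translated equation in
  Tate's normal form (`p ∣ a₁, a₂, a₃`, `p² ∣ a₄, a₆` resp. `p ∣ a₁`, `p² ∣ a₂, a₃`, `p³ ∣ a₄`,
  `p⁴ ∣ a₆`), and its soundness `TamX.sound : check ⟹ c_v = F.c` GIVEN minimality at `v` (supplied
  row-wise by the cell's Kraus–Laska theorem `Rank3Row.isGloballyMinimal_of_mem`, as in parts 2–3);
* exact ROW values: `TamX.valsX` replaces the bracket `{1,3}` of a `TamLocal` certificate by the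
  singleton of a checking `TamX` certificate at the same prime; `tamagawaProduct_memX` /
  `tamagawaProduct_eqX`; the chunk walker `tamWalkX` and `tamagawa_of_tamWalkX` for the census
  supplement `Rank2ObservatoryRank3TamX*` (rows of `rank3Table` with a prime of type `IV` / `IV*`).
References: J. Tate, *Algorithm for determining the type of a singular fiber in an elliptic pencil*,
LNM 476 (1975) §§7–8 [Tate1975]; J. H. Silverman, *Advanced Topics*, GTM 151 (1994), IV.9.4 Steps 5, 8
[Silverman1994]; J. H. Silverman, *The Arithmetic of Elliptic Curves*, 2nd ed. (2009), VII.1 Prop. 1.3(b),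
VII.6 Ex. 7.6 [SilvermanAEC2009]; J. E. Cremona, *Algorithms for Modular Elliptic Curves* (1997) §3.2
[CremonaAlgorithms1997].
-/

set_option linter.dupNamespace false
set_option autoImplicit false

noncomputable section

open scoped NumberField Classical

open IsLocalRing IsDedekindDomain Rat.HeightOneSpectrum WeierstrassCurve
  Literature.NumberTheory.EllipticCurves Literature.NumberTheory.GaloisRepresentations
  Literature.NumberTheory.DiophantineGeometry Literature.NumberTheory.DiophantineGeometry.TateAlgorithm

namespace Summit.BirchSwinnertonDyer.BirchSwinnertonDyer.Rank2Observatory.Tam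

open Tate
open Tate.Step2Cert (pdvd pexact pdvd_iff pexact_iff)

/-! ### Plumbing: `c_v` is the index of `E₀` of the cast of a minimal integer equation -/

section Padic

variable (v : HeightOneSpectrum (𝓞 ℚ))

/-- The residue field of `O_v` (`v` over `p`) is represented by the integers `0 ≤ m < p`
(`O_v ≃ ℤ_p`, `ℤ_p / p ≃ ℤ/p`). [folklore] -/
theorem exists_nat_residue_eq (y : ResidueField (v.adicCompletionIntegers ℚ)) :
    ∃ m : ℕ, m < natGenerator v ∧
      residue (v.adicCompletionIntegers ℚ) ((m : ℤ) : v.adicCompletionIntegers ℚ) = y := by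
  haveI : Fact (natGenerator v).Prime := ⟨prime_natGenerator v⟩
  set e : ResidueField (v.adicCompletionIntegers ℚ) ≃+* ZMod (natGenerator v) :=
    (IsLocalRing.ResidueField.mapEquiv
        (adicCompletionIntegers.padicIntEquiv v).toAlgEquiv.toRingEquiv).trans
      (PadicInt.residueField (p := natGenerator v)) with he
  refine ⟨(e y).val, ZMod.val_lt _, e.injective ?_⟩
  rw [Int.cast_natCast, map_natCast, map_natCast, ZMod.natCast_zmod_val]

/-- **`c_v` read on a translated integer equation.**  Let `M = D • W₀` with `D = (1, r, s, t)`
integral, `W₀ ⊗ ℚ` minimal at the place `v` over `p`, `Δ(M) ≠ 0`, and suppose the index of the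
nonsingular-reduction subgroup of the cast of `M` into `O_v` is `c` in EVERY presentation `p = ϖ ε`
(`ε ∈ O_vˣ`).  Then `c_v(W₀ ⊗ ℚ) = c`: `c_v` does not depend on the equation (*AEC* VII.1.3(b)), for
the minimal equation `M ⊗ ℚ ⊗ ℚ_v` it is the index of that equation's `E₀` (VII.6 Ex. 7.6), and
`M ⊗ ℚ ⊗ ℚ_v` is the base change of the cast of `M`. [cite: SilvermanAEC2009, VII.1 Prop. 1.3(b)] -/
theorem tam_eq_index_intModel {p : ℕ} (hv : natGenerator v = p) (W₀ M : WeierstrassCurve ℤ)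
    (D : VariableChange ℤ) (hD : D.u = 1) (hM : M = D • W₀)
    (hmin : (W₀.baseChange ℚ).IsMinimalAt v) (hΔM : M.Δ ≠ 0) {c : ℕ}
    (hc : ∀ ε : v.adicCompletionIntegers ℚ, IsUnit ε →
      (p : v.adicCompletionIntegers ℚ) = uniformizer (v.adicCompletionIntegers ℚ) * ε →
      ((M.map (Int.castRingHom (v.adicCompletionIntegers ℚ))).nonsingularReductionSubgroup
        (integers_valuationRing_valuation (v.adicCompletionIntegers ℚ) (v.adicCompletion ℚ))).index
          = c) :
    tam W₀ v = c := by
  set O := v.adicCompletionIntegers ℚ with hO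
  have hΔW : M.Δ = W₀.Δ := by rw [hM, variableChange_Δ, hD]; simp
  have hΔ0 : (W₀.baseChange ℚ).Δ ≠ 0 := by
    rw [(Step2Cert.baseChange_eqs W₀).2.2.2.2.2.2.2.2, Int.cast_ne_zero, ← hΔW]; exact hΔM
  haveI : (W₀.baseChange ℚ).IsElliptic := ⟨hΔ0.isUnit⟩
  have hrelq : M.baseChange ℚ = (D.map (algebraMap ℤ ℚ)) • W₀.baseChange ℚ := by
    rw [hM, WeierstrassCurve.baseChange, WeierstrassCurve.baseChange, map_variableChange]
  haveI hMell : (M.baseChange ℚ).IsElliptic := by rw [hrelq]; infer_instance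
  set Y := (W₀.baseChange ℚ).baseChange (v.adicCompletion ℚ) with hY
  set X := (M.baseChange ℚ).baseChange (v.adicCompletion ℚ) with hX
  haveI hXmin : X.IsMinimal O := isMinimalAt_translate v D hD hM hmin
  haveI hXell : X.IsElliptic := by rw [hX, WeierstrassCurve.baseChange]; infer_instance
  haveI hYell : Y.IsElliptic := by rw [hY, WeierstrassCurve.baseChange]; infer_instance
  have hrel : X = ((D.map (algebraMap ℤ ℚ)).map (algebraMap ℚ (v.adicCompletion ℚ))) • Y := by
    rw [hX, hrelq, hY]; simp only [WeierstrassCurve.baseChange, map_variableChange]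
  -- the cast of `M`
  set I := M.map (Int.castRingHom O) with hI
  have hXI : X = I.baseChange (v.adicCompletion ℚ) := by
    rw [hX, hI]
    simp only [WeierstrassCurve.baseChange, WeierstrassCurve.map_map]
    congr 1
    exact RingHom.ext_int _ _
  haveI hImin : (I.baseChange (v.adicCompletion ℚ)).IsMinimal O := hXI ▸ hXmin
  -- a presentation `p = ϖ ε`
  have hpval : Valued.v (((p : O)) : v.adicCompletion ℚ) = WithZero.exp (-((1 : ℕ) : ℤ)) := by
    rw [show ((p : O) : v.adicCompletion ℚ) = algebraMap _ (v.adicCompletion ℚ) (p : O) from rfl,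
      map_natCast, ← map_natCast (algebraMap ℚ (v.adicCompletion ℚ)) p,
      WeierstrassCurve.valued_algebraMap_adicCompletion, ← hv]
    exact_mod_cast Rat.valuation_natGenerator v
  obtain ⟨ε, hε, hpε⟩ := exists_isUnit_eq_uniformizer_pow_mul_of_valued_eq v hpval
  rw [pow_one] at hpε
  -- `c_v(W₀) = c(Y) = c(X) = [X(K) : X₀(K)] = index of `I`'s subgroup`
  change Y.localTamagawaNumber O = c
  rw [← WeierstrassCurve.localTamagawaNumber_variableChange_holds O Y
      ((D.map (algebraMap ℤ ℚ)).map (algebraMap ℚ (v.adicCompletion ℚ))), ← hrel,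
    WeierstrassCurve.localTamagawaNumber_eq_index_goodReductionSubgroup,
    index_goodReductionSubgroup_congr O hXI, goodReductionSubgroup_baseChange_eq]
  exact hc ε hε hpε

end Padic

/-! ### The exact certificate `TamX` -/

/-- An EXACT certificate of `c_p` at a prime of Kodaira type `IV` (`kind 1`: `c = 3` by a root
witness `m`; `kind 2`: `c = 1` by exhaustion) or `IV*` (`kind 3`: `c = 3`; `kind 4`: `c = 1`), on the
translated equation `(1, r, s, t) • W₀` in Tate's normal form, `pⁿ ∥ Δ`. [cite: Silverman1994, IV.9.4] -/
structure TamX where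
  /-- the prime -/
  p : ℕ
  /-- `⌊√p⌋` -/
  sq : ℕ
  /-- `1` = `IV`, root; `2` = `IV`, no root; `3` = `IV*`, root; `4` = `IV*`, no root -/
  kind : ℕ
  /-- translation `x = x' + r` -/
  r : ℤ
  /-- `y = y' + s x' + t` -/
  s : ℤ
  /-- `y = y' + s x' + t` -/
  t : ℤ
  /-- `pⁿ ∥ Δ` -/
  n : ℕ
  /-- the root witness (kinds `1`, `3`) -/
  m : ℤ
  deriving Repr, DecidableEq, Inhabited

namespace TamX

variable (F : TamX) (W : WeierstrassCurve ℤ)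

/-- The exponent `j`: `a₃ = pʲ A₃`, `a₆ = p²ʲ A₆` (`1` for `IV`, `2` for `IV*`). [folklore] -/
def j : ℕ := if F.kind ≤ 2 then 1 else 2

/-- The certified value of `c_p`. [cite: Silverman1994, IV.9.4 Steps 5, 8] -/
def c : ℕ := if F.kind = 1 ∨ F.kind = 3 then 3 else 1

/-- The translated integer equation. [folklore] -/
def model : WeierstrassCurve ℤ := (⟨F.p, F.r, F.s, F.t, F.n, 0, 0⟩ : Step2Cert).model W

/-- `A₃ = a₃ / pʲ`. [folklore] -/
def A3 : ℤ := (F.model W).a₃ / (F.p : ℤ) ^ F.j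

/-- `A₆ = a₆ / p²ʲ`. [folklore] -/
def A6 : ℤ := (F.model W).a₆ / (F.p : ℤ) ^ (2 * F.j)

/-- The value `m² + A₃ m − A₆` of the Step-5/8 quadratic at an integer. [folklore] -/
def quadVal (m : ℤ) : ℤ := m ^ 2 + F.A3 W * m - F.A6 W

/-- Tate's normal form: `p ∣ a₁`, `pʲ ∣ a₂, a₃`, `pʲ⁺¹ ∣ a₄`, `p²ʲ ∣ a₆`. [cite: Silverman1994, IV.9.4] -/
def normB : Bool :=
  pdvd F.p 1 (F.model W).a₁ && pdvd F.p F.j (F.model W).a₂ && pdvd F.p F.j (F.model W).a₃ &&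
    pdvd F.p (F.j + 1) (F.model W).a₄ && pdvd F.p (2 * F.j) (F.model W).a₆

/-- The kernel check: `p` prime, `pⁿ ∥ Δ`, normal form, and the kind's root test.
[cite: Silverman1994, IV.9.4 Steps 5, 8] -/
def check : Bool :=
  TamLocal.primeB F.p F.sq && pexact F.p F.n (F.model W).Δ && F.normB W &&
  (((F.kind == 1 || F.kind == 3) && decide (¬ (F.p : ℤ) ∣ F.A3 W ^ 2 + 4 * F.A6 W) &&
      decide ((F.p : ℤ) ∣ F.quadVal W F.m)) ||
    ((F.kind == 2 || F.kind == 4) &&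
      (List.range F.p).all fun m => !decide ((F.p : ℤ) ∣ F.quadVal W m)))

variable {F W}

/-- `model = (1, r, s, t) • W`. [folklore] -/
theorem model_eq : F.model W = (⟨1, F.r, F.s, F.t⟩ : VariableChange ℤ) • W :=
  Step2Cert.model_eq _ W

/-- **Soundness of the exact certificate, given minimality at `v`**: `c_v(W₀ ⊗ ℚ) = F.c`.
[cite: Tate1975, §§7–8] [cite: Silverman1994, IV.9.4 Steps 5, 8] -/
theorem sound {W₀ : WeierstrassCurve ℤ} {F : TamX} (v : HeightOneSpectrum (𝓞 ℚ))
    (hv : natGenerator v = F.p) (hmin : (W₀.baseChange ℚ).IsMinimalAt v) (hc : F.check W₀ = true) :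
    tam W₀ v = F.c := by
  have hp : F.p.Prime := hv ▸ prime_natGenerator v
  simp only [check, normB, Bool.and_eq_true, Bool.or_eq_true, beq_iff_eq, decide_eq_true_eq,
    pexact_iff, pdvd_iff, List.all_eq_true, List.mem_range, Bool.not_eq_true',
    decide_eq_false_iff_not] at hc
  obtain ⟨⟨⟨-, hΔn, hΔn'⟩, ⟨⟨⟨h1, h2⟩, h3⟩, h4⟩, h6⟩, hkind⟩ := hc
  have hΔM : (F.model W₀).Δ ≠ 0 := fun h0 => hΔn' (h0 ▸ dvd_zero _)
  refine tam_eq_index_intModel v hv W₀ (F.model W₀) ⟨1, F.r, F.s, F.t⟩ rfl model_eq hmin hΔM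
    fun ε hε hpε => ?_
  have hsurj := fun y => exists_nat_residue_eq v y
  rw [hv] at hsurj
  rcases hkind with ⟨⟨hk, hq⟩, hm⟩ | ⟨hk, hno⟩
  · -- a root: `c = 3`
    have hc3 : F.c = 3 := by rcases hk with hk | hk <;> simp [c, hk]
    rw [hc3]
    rcases hk with hk | hk
    · have hj : F.j = 1 := by simp [j, hk]
      simp only [hj, A3, A6, quadVal] at h2 h3 h4 h6 hq hm
      exact index_IV_intCast_eq_three hp hε hpε h1 h2 h3 h4 h6 hq hΔn hΔn' hm
    · have hj : F.j = 2 := by simp [j, hk]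
      simp only [hj, A3, A6, quadVal] at h2 h3 h4 h6 hq hm
      exact index_IVstar_intCast_eq_three hp hε hpε h1 h2 h3 h4 h6 hq hΔn hΔn' hm
  · -- no root: `c = 1`
    have hc1 : F.c = 1 := by rcases hk with hk | hk <;> simp [c, hk]
    rw [hc1]
    rcases hk with hk | hk
    · have hj : F.j = 1 := by simp [j, hk]
      simp only [hj, A3, A6, quadVal] at h2 h3 h4 h6 hno
      exact index_IV_intCast_eq_one hp hε hpε h1 h2 h3 h4 h6 hsurj fun m hm => hno m hm
    · have hj : F.j = 2 := by simp [j, hk]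
      simp only [hj, A3, A6, quadVal] at h2 h3 h4 h6 hno
      exact index_IVstar_intCast_eq_one hp hε hpε h1 h2 h3 h4 h6 hsurj fun m hm => hno m hm

/-! ### Exact rows: a `TamX` certificate sharpens the bracket of the `TamLocal` one at its prime -/

/-- The sharpened local value set: the singleton `{F.c}` of the first exact certificate at `E.p`, if
any, else `E.vals`. [folklore] -/
def valsX (Xs : List TamX) (E : TamLocal) : List ℕ :=
  match Xs.find? (fun F => F.p == E.p) with
  | some F => [F.c]
  | none => E.vals

/-- The sharpened finite set of values of the Tamagawa product. [folklore] -/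
def rowValsX (Es : List TamLocal) (Xs : List TamX) : List ℕ := valsProd (Es.map (valsX Xs))

/-- Every sharpened local set is a singleton. [folklore] -/
def rowExactX (Es : List TamLocal) (Xs : List TamX) : Bool :=
  Es.all fun E => decide ((valsX Xs E).length = 1)

/-- The sharpened product value: the product of the singletons' elements (head of each set). [folklore] -/
def rowValueX (Es : List TamLocal) (Xs : List TamX) : ℕ := (Es.map fun E => (valsX Xs E).headD 1).prod

/-- The row check with exact supplements: the `TamLocal` row check and every `TamX` checks. [folklore] -/
def rowCheckX (Es : List TamLocal) (Xs : List TamX) (W : WeierstrassCurve ℤ) : Bool :=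
  TamLocal.rowCheck Es W && Xs.all fun F => F.check W

variable {Es : List TamLocal} {Xs : List TamX} {W₀ : WeierstrassCurve ℤ}

/-- **Local census at a listed place, sharpened**: `c_v ∈ valsX Xs E`. [cite: Silverman1994, IV.9.4] -/
theorem tam_mem_valsX_of_mem (h : rowCheckX Es Xs W₀ = true)
    (hGM : (W₀.baseChange ℚ).IsGloballyMinimal) {E : TamLocal} (hE : E ∈ Es)
    (v : HeightOneSpectrum (𝓞 ℚ)) (hv : natGenerator v = E.p) : tam W₀ v ∈ valsX Xs E := by
  simp only [rowCheckX, Bool.and_eq_true, List.all_eq_true] at h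
  unfold valsX
  split
  · rename_i F hF
    have hFp : F.p = E.p := by simpa using List.find?_some hF
    rw [List.mem_singleton]
    exact sound v (hv.trans hFp.symm) (hGM.isMinimal v) (h.2 F (List.mem_of_find?_eq_some hF))
  · exact TamLocal.tam_mem_vals_of_mem h.1 hGM hE v hv

/-- **The Tamagawa product lies in the sharpened set** `rowValsX Es Xs`. [cite: Silverman1994, IV.9.4] -/
theorem tamagawaProduct_memX (h : rowCheckX Es Xs W₀ = true)
    (hGM : (W₀.baseChange ℚ).IsGloballyMinimal) :
    (W₀.baseChange ℚ).tamagawaProduct ∈ rowValsX Es Xs := by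
  have h' : TamLocal.rowCheck Es W₀ = true := by
    simp only [rowCheckX, Bool.and_eq_true] at h; exact h.1
  obtain ⟨-, hnd, -⟩ := TamLocal.rowCheck_spec h'
  have key : (W₀.baseChange ℚ).tamagawaProduct = (Es.map fun E => tam W₀ (pl E.p)).prod := by
    change ∏ᶠ v, tam W₀ v = _
    rw [finprod_eq_prod_map_pl (tam W₀) (Es.map (·.p)) hnd
      (fun p hp ↦ TamLocal.prime_of_mem_map h' hp) (TamLocal.tam_eq_one_of_not_mem h'), List.map_map]
    rfl
  rw [key, rowValsX]
  refine prod_mem_valsProd ?_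
  rw [List.forall₂_map_left_iff, List.forall₂_map_right_iff, List.forall₂_same]
  exact fun E hE ↦ tam_mem_valsX_of_mem h hGM hE _
    (natGenerator_pl (TamLocal.prime_of_mem_map h' (List.mem_map.mpr ⟨E, hE, rfl⟩)))

/-- **Exact rows, sharpened**: if every sharpened local set is a singleton, the Tamagawa product IS
`rowValueX Es Xs`. [cite: Silverman1994, IV.9.4] -/
theorem tamagawaProduct_eqX (h : rowCheckX Es Xs W₀ = true)
    (hGM : (W₀.baseChange ℚ).IsGloballyMinimal) (hx : rowExactX Es Xs = true) :
    (W₀.baseChange ℚ).tamagawaProduct = rowValueX Es Xs := by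
  have hm := tamagawaProduct_memX h hGM
  have hvals : Es.map (valsX Xs) = (Es.map fun E => (valsX Xs E).headD 1).map fun c => [c] := by
    rw [List.map_map]
    refine List.map_congr_left fun E hE ↦ ?_
    have h1 : (valsX Xs E).length = 1 := by simpa using List.all_eq_true.mp hx E hE
    obtain ⟨a, ha⟩ := List.length_eq_one_iff.mp h1
    simp [ha]
  rwa [rowValsX, hvals, valsProd_map_singleton, List.mem_singleton] at hm

end TamX

/-! ### The census walker for the exact supplement -/

/-- One-pass position-indexed walk: the pairs `(i, X)` (indices increasing) are checked against the
`i`-th row's integer model (every `TamX` of `X` checks). [folklore] -/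
def tamWalkX : List Rank3Row → ℕ → List (ℕ × List TamX) → Bool
  | _, _, [] => true
  | [], _, _ :: _ => false
  | r :: rs, n, (i, X) :: rest =>
      if i = n then (X.all fun F => F.check r.intModel) && tamWalkX rs (n + 1) rest
      else tamWalkX rs (n + 1) ((i, X) :: rest)

/-- What a passing walk says about each listed pair. [folklore] -/
theorem entry_of_tamWalkX :
    ∀ (rows : List Rank3Row) (n : ℕ) (ps : List (ℕ × List TamX)), tamWalkX rows n ps = true →
      ∀ (i : ℕ) (X : List TamX), (i, X) ∈ ps → n ≤ i ∧ ∃ r : Rank3Row, rows[i - n]? = some r ∧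
        (X.all fun F => F.check r.intModel) = true
  | _, _, [], _, i, X, hm => by simp at hm
  | [], _, _ :: _, h, _, _, _ => by simp [tamWalkX] at h
  | r :: rs, n, (j, d) :: rest, h, i, X, hm => by
    by_cases hj : j = n
    · simp only [tamWalkX, hj, ↓reduceIte, Bool.and_eq_true] at h
      rcases List.mem_cons.mp hm with he | hm'
      · obtain ⟨hin, hcd⟩ := Prod.mk.inj he
        rw [hj] at hin
        exact ⟨by omega, r, by rw [hin, Nat.sub_self]; rfl, by rw [hcd]; exact h.1⟩
      · obtain ⟨hle, r', hr', he'⟩ := entry_of_tamWalkX rs (n + 1) rest h.2 i X hm'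
        refine ⟨by omega, r', ?_, he'⟩
        rw [show i - n = (i - (n + 1)) + 1 by omega, List.getElem?_cons_succ]
        exact hr'
    · simp only [tamWalkX, hj, ↓reduceIte] at h
      obtain ⟨hle, r', hr', he'⟩ := entry_of_tamWalkX rs (n + 1) ((j, d) :: rest) h i X hm
      refine ⟨by omega, r', ?_, he'⟩
      rw [show i - n = (i - (n + 1)) + 1 by omega, List.getElem?_cons_succ]
      exact hr'

/-- **The sharpened census theorem behind every supplement chunk** — NO named fact: if row `i`'s
`TamLocal` row certificate `R` checks (the landed census, `Rank2ObservatoryRank3TamagawaCensus`) and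
`(i, X)` passes the exact walk, then the row's TAMAGAWA PRODUCT lies in `rowValsX R X` and equals
`rowValueX R X` when every sharpened set is a singleton. [cite: Silverman1994, IV.9.4]
[cite: CremonaAlgorithms1997, Table 1] -/
theorem tamagawa_of_tamWalkX {ps : List (ℕ × List TamX)} (h : tamWalkX rank3Table 0 ps = true)
    {i : ℕ} {X : List TamX} (hm : (i, X) ∈ ps) {R : List TamLocal} (hi : i < rank3Table.length)
    (hR : TamLocal.rowCheck R (rank3Table[i]'hi).intModel = true) :
    TamX.rowCheckX R X (rank3Table[i]'hi).intModel = true ∧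
      (rank3Table[i]'hi).curve.tamagawaProduct ∈ TamX.rowValsX R X ∧
      (TamX.rowExactX R X = true →
        (rank3Table[i]'hi).curve.tamagawaProduct = TamX.rowValueX R X) := by
  obtain ⟨-, r, hrc, hc⟩ := entry_of_tamWalkX _ 0 ps h i X hm
  rw [Nat.sub_zero] at hrc
  obtain ⟨hi', hr⟩ := List.getElem?_eq_some_iff.mp hrc
  subst hr
  have hGM : ((rank3Table[i]'hi).intModel.baseChange ℚ).IsGloballyMinimal := by
    rw [← Rank3Row.curve_eq_baseChange]
    exact Rank3Row.isGloballyMinimal_of_mem (List.getElem_mem hi)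
  have hcx : TamX.rowCheckX R X (rank3Table[i]'hi).intModel = true := by
    simp only [TamX.rowCheckX, Bool.and_eq_true]; exact ⟨hR, hc⟩
  refine ⟨hcx, ?_, fun hx ↦ ?_⟩
  · rw [Rank3Row.curve_eq_baseChange]; exact TamX.tamagawaProduct_memX hcx hGM
  · rw [Rank3Row.curve_eq_baseChange]; exact TamX.tamagawaProduct_eqX hcx hGM hx

/-! ### Kernel self-test: the first census row with a prime of type `IV` -/

/-- Row `23` = `26284a1` (`[0,1,0,-9,16]`, bad primes `2` of type `IV` and `6571` of type `I₁`): stage 1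
certified `∏ c_p ∈ {1, 3}`; the exact certificate (`2 ∣ m² + (a₃/2) m − a₆/4` at `m = 0` on the
translated equation `(1, 1, 0, 1) • W`) makes it `∏ c_p = 3` — evaluated IN THE KERNEL, NO named fact.
[cite: Silverman1994, IV.9.4 Step 5] [cite: CremonaAlgorithms1997, Table 1] -/
theorem tamagawaProduct_26284a1 :
    (rank3Table[23]'(by rw [rank3Table_length]; omega)).curve.tamagawaProduct = 3 :=
  ((tamagawa_of_tamWalkX (ps := [(23, [⟨2, 1, 1, 1, 0, 1, 4, 0⟩])])
    (R := [⟨2, 1, 4, 0, 1, 0, 1, 4, 4, 2, 3⟩, ⟨6571, 81, 1, 5656, 0, 0, 0, 1, 0, 0, 1⟩])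
    (by decide +kernel) (List.mem_singleton.mpr rfl) (by rw [rank3Table_length]; omega)
    (by decide +kernel)).2.2 (by decide +kernel)).trans (by decide +kernel)

end Summit.BirchSwinnertonDyer.BirchSwinnertonDyer.Rank2Observatory.Tam

end
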